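import Summits.Ventures.PercRepro.C026GluingH
import Summits.Ventures.PercRepro.C026StarPrime

/-!
# The composition theorem: `D-free` composes under 3-terminal gluing (p6, gen 8)

mine-3's composition theorem (`proofs/MINE3-Q3-proof.md` §26.8, statement sheet §26.9, lemmas (L6)–(L7)):
if the D-free inequality holds for the two parts of a 3-terminal gluing, it holds for the gluing.

* `hScore` — the score `[o1] + [o2] − [BAD]` of a configuration; `dFreeIneq_iff_sum_hScore`: the
  D-free inequality is `0 ≤ Σ_{bot} score`;
* **(L7, pointwise)** `score_cert`: for the bits `(o1, o2, BAD)` of the two parts (with `o1 ∧ o2 ⇒ BAD`),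
  the score of the gluing (`o1 = o1₁ ∨ o1₀`, `o2 = o2₁ ∨ o2₀`, `BAD = BAD₁ ∨ BAD₀ ∨ (o1 ∧ o2)`) is at
  least `[¬o1₁ ∧ ¬o2₁]·score₀ + [BAD₀ ⟺ o1₁ ∧ o2₁ of part 0]·score₁` — the paper's chain
  `Δ(G) ≥ (none₁ + KL₁)·Δ₀ + (none₀ + Kc₀ + Lc₀ + KLc₂₀)·Δ₁ + …` read coefficientwise (64 cases);
* **(L6)** the sum over `bot(G)` is the double sum over `bot(G₁) × bot(G₀)` through `sideEquiv`, and
  the three bits of `G` are those of the parts by (L1), (L4), (L5) (`summand_le`);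
* **`dFreeIneq_of_gluing`** — the theorem of record — and the corollary `dFreeIneq_of_gluing_starPrime`
  (parts satisfying `(★′)`).
-/

namespace PercRepro

namespace MultiGraph

section GluingCount

variable {V E : Type*}

open Classical in
/-- The score of a configuration: `[o1] + [o2] − [BAD]`. -/
noncomputable def hScore (G : MultiGraph V E) (ω : Config E) (a b c : V) : ℤ :=
  (if G.HO1 ω a b c then 1 else 0) + (if G.HO2 ω a b c then 1 else 0) -
    (if G.HBad ω a b c then 1 else 0)

open Classical in
/-- **The D-free inequality is the nonnegativity of the total score over `bot`.** -/
theorem dFreeIneq_iff_sum_hScore [Fintype E] [DecidableEq E] (G : MultiGraph V E) (a b c : V) :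
    G.DFreeIneq a b c ↔
      0 ≤ ∑ ω : Config E, if G.IsBot ω a b c then G.hScore ω a b c else 0 := by
  rw [dFreeIneq_iff_hGraph]
  have key : (∑ ω : Config E, if G.IsBot ω a b c then G.hScore ω a b c else 0) =
      (((Finset.univ.filter fun ω : Config E =>
          G.IsBot ω a b c ∧ G.HConnAvoid ω c (G.cluster ω b) c a).card : ℕ) : ℤ) +
        ((Finset.univ.filter fun ω : Config E =>
          G.IsBot ω a b c ∧ G.HConnAvoid ω c (G.cluster ω a) c b).card : ℕ) -
        ((Finset.univ.filter fun ω : Config E => G.IsBot ω a b c ∧ G.HConn ω c a b).card : ℕ) := by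
    simp only [Finset.card_filter, Nat.cast_sum, Nat.cast_ite, Nat.cast_one, Nat.cast_zero,
      ← Finset.sum_add_distrib, ← Finset.sum_sub_distrib]
    refine Finset.sum_congr rfl fun ω _ => ?_
    unfold hScore HO1 HO2 HBad
    split_ifs <;> simp_all
  rw [key]
  constructor
  · intro h
    have h' : ((Finset.univ.filter fun ω : Config E =>
        G.IsBot ω a b c ∧ G.HConn ω c a b).card : ℤ) ≤
        ((Finset.univ.filter fun ω : Config E =>
          G.IsBot ω a b c ∧ G.HConnAvoid ω c (G.cluster ω b) c a).card : ℕ) +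
        ((Finset.univ.filter fun ω : Config E =>
          G.IsBot ω a b c ∧ G.HConnAvoid ω c (G.cluster ω a) c b).card : ℕ) := by
      exact_mod_cast h
    omega
  · intro h
    have h' : ((Finset.univ.filter fun ω : Config E =>
        G.IsBot ω a b c ∧ G.HConn ω c a b).card : ℤ) ≤
        ((Finset.univ.filter fun ω : Config E =>
          G.IsBot ω a b c ∧ G.HConnAvoid ω c (G.cluster ω b) c a).card : ℕ) +
        ((Finset.univ.filter fun ω : Config E =>
          G.IsBot ω a b c ∧ G.HConnAvoid ω c (G.cluster ω a) c b).card : ℕ) := by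
      omega
    exact_mod_cast h'

variable {G : MultiGraph V E} {a b c : V} {side : E → Bool}

open Classical in
/-- **(L7, pointwise)** The score of the gluing against the parts' scores.  With the parts' bits
`(o1ᵢ, o2ᵢ, BADᵢ)` and `o1 = o1₁ ∨ o1₀`, `o2 = o2₁ ∨ o2₀`, `BAD = BAD₁ ∨ BAD₀ ∨ (o1 ∧ o2)`:
`[o1] + [o2] − [BAD] ≥ [¬o1₁ ∧ ¬o2₁]·score₀ + [BAD₀ ↔ o1₀ ∧ o2₀]·score₁` — the coefficients of
`Δ₀` and `Δ₁` in mine-3's chain (`none₁ + KL₁` and `none₀ + Kc₀ + Lc₀ + KLc₂₀`). -/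
theorem score_cert (P1 P2 P3 Q1 Q2 Q3 : Prop) (hP : P1 → P2 → P3) (hQ : Q1 → Q2 → Q3) :
    (if ¬ P1 ∧ ¬ P2 then (1 : ℤ) else 0) *
        ((if Q1 then 1 else 0) + (if Q2 then 1 else 0) - (if Q3 then 1 else 0)) +
      ((if P1 then 1 else 0) + (if P2 then 1 else 0) - (if P3 then 1 else 0)) *
        (if (Q3 ↔ Q1 ∧ Q2) then (1 : ℤ) else 0) ≤
    (if P1 ∨ Q1 then (1 : ℤ) else 0) + (if P2 ∨ Q2 then 1 else 0) -
      (if P3 ∨ Q3 ∨ ((P1 ∨ Q1) ∧ (P2 ∨ Q2)) then 1 else 0) := by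
  rcases Classical.em P1 with h1 | h1 <;> rcases Classical.em P2 with h2 | h2 <;>
    rcases Classical.em P3 with h3 | h3 <;>
    rcases Classical.em Q1 with h4 | h4 <;> rcases Classical.em Q2 with h5 | h5 <;>
    rcases Classical.em Q3 with h6 | h6 <;>
    first
      | exact absurd (hP h1 h2) h3
      | exact absurd (hQ h4 h5) h6
      | simp [h1, h2, h3, h4, h5, h6]

open Classical in
/-- **(L6)** The summand of the gluing against the parts' summands, at one configuration. -/
theorem summand_le (hg : G.IsGluing a b c side) (hab : a ≠ b) (hac : a ≠ c) (hbc : b ≠ c)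
    (ω : Config E) :
    (if (G.part side true).IsBot (sideRestrict ω side true) a b c then
        (if ¬ (G.part side true).HO1 (sideRestrict ω side true) a b c ∧
            ¬ (G.part side true).HO2 (sideRestrict ω side true) a b c then (1 : ℤ) else 0)
      else 0) *
      (if (G.part side false).IsBot (sideRestrict ω side false) a b c then
        (G.part side false).hScore (sideRestrict ω side false) a b c else 0) +
    (if (G.part side true).IsBot (sideRestrict ω side true) a b c then
        (G.part side true).hScore (sideRestrict ω side true) a b c else 0) *
      (if (G.part side false).IsBot (sideRestrict ω side false) a b c then
        (if ((G.part side false).HBad (sideRestrict ω side false) a b c ↔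
            (G.part side false).HO1 (sideRestrict ω side false) a b c ∧
              (G.part side false).HO2 (sideRestrict ω side false) a b c) then (1 : ℤ) else 0)
      else 0) ≤
    (if G.IsBot ω a b c then G.hScore ω a b c else 0) := by
  by_cases hb : G.IsBot ω a b c
  · have hb' := (isBot_gluing_iff hg ω).mp hb
    rw [if_pos hb, if_pos hb'.1, if_pos hb'.2, if_pos hb'.1, if_pos hb'.2]
    unfold hScore
    simp only [hO1_gluing_iff hg hb hab hac hbc, hO2_gluing_iff hg hb hab hac hbc,
      hBad_gluing_iff hg hb hab hac hbc]
    exact score_cert _ _ _ _ _ _ (fun h1 h2 => hBad_of_hO1_hO2 h1 h2)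
      (fun h1 h2 => hBad_of_hO1_hO2 h1 h2)
  · rw [if_neg hb]
    have hb' : ¬ ((G.part side true).IsBot (sideRestrict ω side true) a b c ∧
        (G.part side false).IsBot (sideRestrict ω side false) a b c) :=
      fun h => hb ((isBot_gluing_iff hg ω).mpr h)
    rcases not_and_or.mp hb' with h | h
    · simp [h]
    · simp [h]

open Classical in
/-- **THE COMPOSITION THEOREM** (mine-3 §26.8): if the D-free inequality holds for both parts of a
3-terminal gluing, it holds for the gluing.  Proof: the sum of the scores over `bot(G)` is the double
sum over `bot(G₁) × bot(G₀)` (`sideEquiv`), bounded below pointwise by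
`[¬o1₁ ∧ ¬o2₁]·score₀ + score₁·[BAD₀ ↔ o1₀ ∧ o2₀]` (`summand_le`), whose double sum is
`(Σ [¬o1₁ ∧ ¬o2₁])·Δ₀ + Δ₁·(Σ [BAD₀ ↔ o1₀ ∧ o2₀]) ≥ 0`. -/
theorem dFreeIneq_of_gluing [Fintype E] [DecidableEq E] (G : MultiGraph V E) (a b c : V)
    (hab : a ≠ b) (hac : a ≠ c) (hbc : b ≠ c) (side : E → Bool) (hg : G.IsGluing a b c side)
    (h₁ : (G.part side true).DFreeIneq a b c) (h₀ : (G.part side false).DFreeIneq a b c) :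
    G.DFreeIneq a b c := by
  rw [dFreeIneq_iff_sum_hScore] at h₁ h₀ ⊢
  rw [← (sideEquiv side).symm.sum_comp, Fintype.sum_prod_type]
  -- the four one-sided sums
  set A : Config {e // side e = true} → ℤ := fun ω₁ =>
    if (G.part side true).IsBot ω₁ a b c then
      (if ¬ (G.part side true).HO1 ω₁ a b c ∧ ¬ (G.part side true).HO2 ω₁ a b c then (1 : ℤ) else 0)
    else 0 with hA
  set B : Config {e // side e = false} → ℤ := fun ω₀ =>
    if (G.part side false).IsBot ω₀ a b c then (G.part side false).hScore ω₀ a b c else 0 with hB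
  set D : Config {e // side e = true} → ℤ := fun ω₁ =>
    if (G.part side true).IsBot ω₁ a b c then (G.part side true).hScore ω₁ a b c else 0 with hD
  set C : Config {e // side e = false} → ℤ := fun ω₀ =>
    if (G.part side false).IsBot ω₀ a b c then
      (if ((G.part side false).HBad ω₀ a b c ↔
          (G.part side false).HO1 ω₀ a b c ∧ (G.part side false).HO2 ω₀ a b c) then (1 : ℤ) else 0)
    else 0 with hC
  have hAnn : 0 ≤ ∑ ω₁, A ω₁ := Finset.sum_nonneg fun ω₁ _ => by
    simp only [hA]
    split_ifs <;> norm_num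
  have hCnn : 0 ≤ ∑ ω₀, C ω₀ := Finset.sum_nonneg fun ω₀ _ => by
    simp only [hC]
    split_ifs <;> norm_num
  have hB0 : 0 ≤ ∑ ω₀, B ω₀ := h₀
  have hD0 : 0 ≤ ∑ ω₁, D ω₁ := h₁
  calc (0 : ℤ) ≤ (∑ ω₁, A ω₁) * (∑ ω₀, B ω₀) + (∑ ω₁, D ω₁) * (∑ ω₀, C ω₀) :=
        add_nonneg (mul_nonneg hAnn hB0) (mul_nonneg hD0 hCnn)
    _ = ∑ ω₁, ∑ ω₀, (A ω₁ * B ω₀ + D ω₁ * C ω₀) := by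
        simp only [Finset.sum_mul_sum, Finset.sum_add_distrib]
    _ ≤ ∑ ω₁, ∑ ω₀, (if G.IsBot ((sideEquiv side).symm (ω₁, ω₀)) a b c then
          G.hScore ((sideEquiv side).symm (ω₁, ω₀)) a b c else 0) := by
        refine Finset.sum_le_sum fun ω₁ _ => Finset.sum_le_sum fun ω₀ _ => ?_
        have h := summand_le hg hab hac hbc ((sideEquiv side).symm (ω₁, ω₀))
        simp only [sideRestrict_symm_true, sideRestrict_symm_false] at h
        exact h

/-- **Corollary**: a gluing of two parts satisfying mine-3's `(★′)` satisfies the D-free inequality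
(via `dFreeIneq_of_starPrime`). -/
theorem dFreeIneq_of_gluing_starPrime [Fintype E] [DecidableEq E] (G : MultiGraph V E) (a b c : V)
    (hab : a ≠ b) (hac : a ≠ c) (hbc : b ≠ c) (side : E → Bool) (hg : G.IsGluing a b c side)
    (h₁ : (G.part side true).StarPrimeIneq a b c) (h₀ : (G.part side false).StarPrimeIneq a b c) :
    G.DFreeIneq a b c :=
  dFreeIneq_of_gluing G a b c hab hac hbc side hg (dFreeIneq_of_starPrime _ h₁)
    (dFreeIneq_of_starPrime _ h₀)

end GluingCount

end MultiGraph

end PercRepro
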